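import Summits.Schanuel.Schanuel.Theorems.RootDecomp1KCommonRadixCell04

/-!
# RootDecomp1KCommonRadixCell — lens 1, generation 37 «COMMON-RADIX WALL CELL of 33364» (the dependent-base wall `(1, ℓ₂, ℓ₄)`) — continuation (RootDecomp1KCommonRadixCell05): §7 hypothesis-free certificates: `liouvilleNumber_strictAnti`, injectivity, the two-scale form bound `form_lower_bound_V` for `(1, ℓ₂, ℓ₄)` (`maxHeartbeats 800000` as in the source)

(lens-1 g37 `RootDecomp1KCommonRadixCell.lean`, sha256 2ee3a3e8…2418, own farm rc 0 · 0 sorry · axioms std; critic VERDICT STATUS L1748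
(credit K-R23 (β′), PORT GO LOW); port by census-1 gen 16 in seven parts `RootDecomp1KCommonRadixCell01`–`07` — see the PORT NOTE of part 01;
`--supports stmt-Schanuel-33364`; rung 0.)
-/

noncomputable section

open Complex IntermediateField Polynomial
open Summit.Schanuel.Schanuel.Theorems.RootDecomp1KHyper
open Summit.Schanuel.Schanuel.Theorems.RootDecomp1KHyper.HyperCell
open Summit.Schanuel.Schanuel.Theorems.RootDecomp1KGeneric
open Summit.Schanuel.Schanuel.Theorems.RootDecomp1KRelLiouvilleCell
open Summit.Schanuel.Schanuel.Theorems.RootDecomp1KLogLogCell (LogLogLiouville logLogLiouville_of_logSqLiouville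
  logLogLiouville_of_logHyperLiouville logLogLiouville_of_hyperLiouville)
open Summit.Schanuel.Schanuel.Theorems.RootDecomp1KTwoBaseCell (partialSum_pos' liouvilleNumber_le partialSum_lt_two numerator_lt exists_int_mul_eq_map' algebraicIndependent_of_forall_int' norm_pow_sub_pow_le' norm_prod_pow_sub_prod_pow_le norm_aeval_sub_aeval_le growth_beats lpart
  tpart lpart_apply tpart_apply eq_of_parts_eq psNumer partialSum_eq_psNumer_div coprime_psNumer liouvilleNumber_sub_rat_lower_loglog not_logLogLiouville_liouvilleNumber liouvilleNumber_three_lt_one sb_of_range_eq')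

namespace Summit.Schanuel.Schanuel.Theorems.RootDecomp1KCommonRadixCell

open LiouvilleNumber
open scoped Nat

/-- Upper bound for the tail in base `m ≥ 2`: `r_k ≤ 2·m^{-(k+1)!}` (g36, verbatim). -/
private theorem remainder_le {m : ℝ} (hm : 2 ≤ m) (k : ℕ) : remainder m k ≤ 2 / m ^ (k + 1)! := by
  have m1 : (1 : ℝ) < m := by linarith
  have m0 : (0 : ℝ) < m := by linarith
  have h := remainder_lt' k m1
  have hhalf : (1 : ℝ) / m ≤ 1 / 2 := one_div_le_one_div_of_le two_pos hm
  have hpos : (0 : ℝ) < 1 - 1 / m := by linarith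
  have hinv : (1 - 1 / m)⁻¹ ≤ 2 := by
    rw [inv_le_comm₀ hpos two_pos]
    linarith
  have hmk : (0 : ℝ) < 1 / m ^ (k + 1)! := by positivity
  calc remainder m k ≤ (1 - 1 / m)⁻¹ * (1 / m ^ (k + 1)!) := h.le
    _ ≤ 2 * (1 / m ^ (k + 1)!) := mul_le_mul_of_nonneg_right hinv hmk.le
    _ = 2 / m ^ (k + 1)! := by ring

/-! ## §7  Hypothesis-free certificates: `ℓ_b` is not log-log-Liouville (g36), `b ↦ ℓ_b` is injective, and the
## two-scale form bound for the dependent wall `(1, ℓ₂, ℓ₄)` -/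

section FormBound
/-! (g36 §6, verbatim: `two_pow_le_two_mul_factorial` … `one_lt_liouvilleNumber_two`) -/
open LiouvilleNumber
open scoped Nat

/-- `2^K ≤ 2·K!`. -/
private theorem two_pow_le_two_mul_factorial (K : ℕ) : 2 ^ K ≤ 2 * K ! := by
  induction K with
  | zero => simp
  | succ n ih =>
    rcases Nat.eq_zero_or_pos n with h0 | hpos
    · subst h0; simp
    · rw [pow_succ, Nat.factorial_succ]
      calc 2 ^ n * 2 ≤ 2 * n ! * 2 := Nat.mul_le_mul_right _ ih
        _ = 2 * (2 * n !) := by ring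
        _ ≤ 2 * ((n + 1) * n !) := by
            apply Nat.mul_le_mul_left; exact Nat.mul_le_mul_right _ (by omega)

/-- `exp 4 ≤ 100`, `exp 1 ≤ 4`, `2 ≤ exp 1`, `6 ≤ exp 2` (decimal bounds on `e`). -/
private theorem exp_four_le : Real.exp 4 ≤ 100 := by
  have h : Real.exp 4 = Real.exp 1 ^ 4 := by rw [← Real.exp_nat_mul]; norm_num
  rw [h]
  have h1 := Real.exp_one_lt_d9
  have h2 : Real.exp 1 ^ 4 ≤ (2.7182818286 : ℝ) ^ 4 :=
    pow_le_pow_left₀ (Real.exp_pos _).le h1.le 4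
  exact h2.trans (by norm_num)

/-- `e ≤ 4`. -/
private theorem exp_one_le_four : Real.exp 1 ≤ 4 := by
  have := Real.exp_one_lt_d9; linarith

/-- `2 ≤ e`. -/
private theorem two_le_exp_one : (2 : ℝ) ≤ Real.exp 1 := by
  have := Real.exp_one_gt_d9; linarith

/-- `6 ≤ e²`. -/
private theorem six_le_exp_two : (6 : ℝ) ≤ Real.exp 2 := by
  have h : Real.exp 2 = Real.exp 1 ^ 2 := by rw [← Real.exp_nat_mul]; norm_num
  rw [h]
  have h1 := Real.exp_one_gt_d9
  calc (6 : ℝ) ≤ (2.7182818283 : ℝ) ^ 2 := by norm_num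
    _ ≤ Real.exp 1 ^ 2 := pow_le_pow_left₀ (by norm_num) h1.le 2

/-- `1 < ℓ₂`. -/
private theorem one_lt_liouvilleNumber_two : 1 < liouvilleNumber 2 := by
  have h := partialSum_add_remainder (by norm_num : (1 : ℝ) < 2) 1
  have hp : partialSum 2 1 = 1 := by
    simp [partialSum, Finset.sum_range_succ]; norm_num
  have hr := remainder_pos (by norm_num : (1 : ℝ) < 2) 1
  linarith

/-- `ℓ₄ < 1` (numerics for the range bookkeeping). -/
theorem liouvilleNumber_four_lt_one : liouvilleNumber 4 < 1 := by
  have h := partialSum_add_remainder (by norm_num : (1 : ℝ) < 4) 1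
  have hp : partialSum 4 1 = 1 / 2 := by
    simp [partialSum, Finset.sum_range_succ]; norm_num
  have hr : remainder 4 1 ≤ 2 / 4 ^ (1 + 1)! := remainder_le (by norm_num) 1
  norm_num at hr
  linarith

/-- **`b ↦ ℓ_b` is strictly decreasing on `b ≥ 2`** (termwise comparison, strict at the first term). -/
theorem liouvilleNumber_strictAnti {b b' : ℕ} (hb : 2 ≤ b) (hbb' : b < b') :
    liouvilleNumber (b' : ℝ) < liouvilleNumber (b : ℝ) := by
  have hb1 : (1 : ℝ) < b := by exact_mod_cast (by omega : 1 < b)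
  have hb'1 : (1 : ℝ) < b' := by exact_mod_cast (by omega : 1 < b')
  have hbb'R : (b : ℝ) < b' := by exact_mod_cast hbb'
  have hb0 : (0 : ℝ) < b := by linarith
  unfold liouvilleNumber
  refine Summable.tsum_lt_tsum (i := 0) (fun n => ?_) ?_ (LiouvilleNumber.summable hb'1)
    (LiouvilleNumber.summable hb1)
  · exact one_div_le_one_div_of_le (by positivity) (pow_le_pow_left₀ hb0.le hbb'R.le _)
  · simp only [Nat.factorial_zero, pow_one]
    exact one_div_lt_one_div_of_lt hb0 hbb'R

/-- Hence `ℓ_b = ℓ_{b'}` with `b, b' ≥ 2` forces `b = b'`. -/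
theorem liouvilleNumber_base_injective {b b' : ℕ} (hb : 2 ≤ b) (hb' : 2 ≤ b')
    (h : liouvilleNumber (b : ℝ) = liouvilleNumber (b' : ℝ)) : b = b' := by
  rcases lt_trichotomy b b' with hlt | heq | hgt
  · exact absurd h (liouvilleNumber_strictAnti hb hlt).ne'
  · exact heq
  · exact absurd h (liouvilleNumber_strictAnti hb' hgt).ne

/-! ### The two-scale form bound for the dependent-base wall `(1, ℓ₂, ℓ₄)` (common denominator `8^{K!}`) -/

/-- Approximation at scale `K`: `|φ − Φ_K| ≤ 2H · 2^{−(K+1)!}`. -/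
private theorem form_approx (g : Fin 3 → ℤ) (K : ℕ) :
    |((g 0 : ℝ) + g 1 * liouvilleNumber 2 + g 2 * liouvilleNumber 4) -
      ((g 0 : ℝ) + g 1 * partialSum 2 K + g 2 * partialSum 4 K)| ≤
      2 * (∑ i, (|g i| : ℝ)) / 2 ^ (K + 1)! := by
  have h2 := partialSum_add_remainder (by norm_num : (1 : ℝ) < 2) K
  have h3 := partialSum_add_remainder (by norm_num : (1 : ℝ) < 4) K
  have r2le : remainder 2 K ≤ 2 / 2 ^ (K + 1)! := remainder_le (by norm_num) K
  have r3le : remainder 4 K ≤ 2 / 2 ^ (K + 1)! := by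
    refine (remainder_le (by norm_num) K).trans ?_
    gcongr; norm_num
  have r2pos := remainder_pos (by norm_num : (1 : ℝ) < 2) K
  have r3pos := remainder_pos (by norm_num : (1 : ℝ) < 4) K
  have e : ((g 0 : ℝ) + g 1 * liouvilleNumber 2 + g 2 * liouvilleNumber 4) -
      ((g 0 : ℝ) + g 1 * partialSum 2 K + g 2 * partialSum 4 K) =
      g 1 * remainder 2 K + g 2 * remainder 4 K := by rw [← h2, ← h3]; ring
  rw [e]
  have hsum : |(g 1 : ℝ)| + |(g 2 : ℝ)| ≤ ∑ i, (|g i| : ℝ) := by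
    rw [Fin.sum_univ_three]; linarith [abs_nonneg (g 0 : ℝ)]
  calc |(g 1 : ℝ) * remainder 2 K + g 2 * remainder 4 K|
      ≤ |(g 1 : ℝ)| * remainder 2 K + |(g 2 : ℝ)| * remainder 4 K := by
        refine (abs_add_le _ _).trans ?_
        rw [abs_mul, abs_mul, abs_of_pos r2pos, abs_of_pos r3pos]
    _ ≤ |(g 1 : ℝ)| * (2 / 2 ^ (K + 1)!) + |(g 2 : ℝ)| * (2 / 2 ^ (K + 1)!) := by
        gcongr
    _ = 2 * (|(g 1 : ℝ)| + |(g 2 : ℝ)|) / 2 ^ (K + 1)! := by ring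
    _ ≤ 2 * (∑ i, (|g i| : ℝ)) / 2 ^ (K + 1)! := by gcongr

/-- Scale lower bound: a NON-ZERO value `Φ_K = g₀ + g₁ s_K + g₂ t_K` is `≥ 8^{−K!}` (common denominator
`2^{K!}·4^{K!} = 8^{K!}`). -/
private theorem form_scale_lower (g : Fin 3 → ℤ) (K : ℕ)
    (hne : (g 0 : ℝ) + g 1 * partialSum 2 K + g 2 * partialSum 4 K ≠ 0) :
    1 / (8 : ℝ) ^ K ! ≤ |(g 0 : ℝ) + g 1 * partialSum 2 K + g 2 * partialSum 4 K| := by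
  obtain ⟨p2, hp2⟩ := partialSum_eq_rat (by norm_num : 0 < 2) K
  obtain ⟨p3, hp3⟩ := partialSum_eq_rat (by norm_num : 0 < 4) K
  push_cast at hp2 hp3
  set I : ℤ := g 0 * 8 ^ K ! + g 1 * p2 * 4 ^ K ! + g 2 * p3 * 2 ^ K ! with hI
  have h6 : (8 : ℝ) ^ K ! = 2 ^ K ! * 4 ^ K ! := by rw [← mul_pow]; norm_num
  have hΦ : (g 0 : ℝ) + g 1 * partialSum 2 K + g 2 * partialSum 4 K = (I : ℝ) / 8 ^ K ! := by
    rw [hp2, hp3, hI]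
    push_cast
    rw [h6]
    field_simp
  rw [hΦ] at hne ⊢
  have hI0 : I ≠ 0 := by
    intro h0; apply hne; rw [h0]; simp
  have hI1 : (1 : ℝ) ≤ |(I : ℝ)| := by exact_mod_cast Int.one_le_abs hI0
  rw [abs_div, abs_of_pos (by positivity : (0 : ℝ) < 8 ^ K !)]
  exact div_le_div_of_nonneg_right hI1 (by positivity)

/-- **Two scales (dependent bases):** if `Φ_N = Φ_{N+1} = 0` then `g₁ 2^{(N+1)!} + g₂ = 0` (multiply the scale
difference by `4^{(N+1)!} = (2^{(N+1)!})²`), hence `g₁ = g₂ = 0` once `|g₂| < 2^{(N+1)!}`. -/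
private theorem form_two_scale (g : Fin 3 → ℤ) (N : ℕ)
    (h0 : (g 0 : ℝ) + g 1 * partialSum 2 N + g 2 * partialSum 4 N = 0)
    (h1 : (g 0 : ℝ) + g 1 * partialSum 2 (N + 1) + g 2 * partialSum 4 (N + 1) = 0)
    (hsmall : |g 2| < (2 : ℤ) ^ (N + 1)!) : g 1 = 0 ∧ g 2 = 0 := by
  rw [partialSum_succ, partialSum_succ] at h1
  have hd : (g 1 : ℝ) / 2 ^ (N + 1)! + g 2 / 4 ^ (N + 1)! = 0 := by linear_combination h1 - h0
  have h4 : (4 : ℝ) ^ (N + 1)! = 2 ^ (N + 1)! * 2 ^ (N + 1)! := by rw [← mul_pow]; norm_num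
  have hz : (g 1 : ℝ) * 2 ^ (N + 1)! + g 2 = 0 := by
    have h2 : (2 : ℝ) ^ (N + 1)! ≠ 0 := by positivity
    rw [h4] at hd
    field_simp at hd
    linear_combination hd
  have hzZ : g 1 * 2 ^ (N + 1)! + g 2 = (0 : ℤ) := by exact_mod_cast hz
  have hg1 : g 1 = 0 := by
    by_contra hne
    have h2 : g 2 = -(g 1 * 2 ^ (N + 1)!) := by linear_combination hzZ
    have h3 : (2 : ℤ) ^ (N + 1)! ≤ |g 2| := by
      rw [h2, abs_neg, abs_mul, abs_of_pos (by positivity : (0 : ℤ) < 2 ^ (N + 1)!)]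
      have h4 : 1 ≤ |g 1| := Int.one_le_abs hne
      nlinarith [pow_pos (by norm_num : (0 : ℤ) < 2) (N + 1)!]
    exact absurd hsmall (not_lt.mpr h3)
  refine ⟨hg1, ?_⟩
  rw [hg1, zero_mul, zero_add] at hzZ
  exact hzZ

/-- `8 ≤ e³`. -/
private theorem eight_le_exp_three : (8 : ℝ) ≤ Real.exp 3 := by
  have h : Real.exp 3 = Real.exp 1 ^ 3 := by rw [← Real.exp_nat_mul]; norm_num
  rw [h]
  calc (8 : ℝ) = 2 ^ 3 := by norm_num
    _ ≤ Real.exp 1 ^ 3 := pow_le_pow_left₀ (by norm_num) two_le_exp_one 3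

set_option maxHeartbeats 800000 in
/-- **THE TWO-SCALE FORM BOUND for the dependent wall** (hypothesis-free): every non-zero integer form in
`(1, ℓ₂, ℓ₄)` satisfies `exp(−(1+Σ|gᵢ|)^11) ≤ |g₀ + g₁ℓ₂ + g₂ℓ₄|`.  (Scale `N ≥ 3` least with `4H ≤ 2^{N!}`; at one of
the scales `N, N+1` the truncated form is non-zero — `form_two_scale` — hence `≥ 8^{−K!}`, twice the approximation
error; and `(N+1)! ≤ 64 (1+H)^3` by minimality.) -/
theorem form_lower_bound_V (g : Fin 3 → ℤ) (hg : g ≠ 0) :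
    Real.exp (-((1 + ∑ i, (|g i| : ℝ)) ^ 11)) ≤
      |(g 0 : ℝ) + g 1 * liouvilleNumber 2 + g 2 * liouvilleNumber 4| := by
  classical
  set HR : ℝ := ∑ i, (|g i| : ℝ) with hHR
  have hHR0 : 0 ≤ HR := by
    rw [hHR]; exact Finset.sum_nonneg fun i _ => by exact_mod_cast abs_nonneg (g i)
  have hexp1 : Real.exp (-((1 + HR) ^ 11)) ≤ 1 := by
    rw [Real.exp_le_one_iff]
    have : (0 : ℝ) ≤ (1 + HR) ^ 11 := by positivity
    linarith
  by_cases h12 : g 1 = 0 ∧ g 2 = 0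
  · -- `φ = g₀`, a non-zero integer
    have hg0 : g 0 ≠ 0 := by
      intro h0; apply hg; funext i
      fin_cases i <;> simp [h0, h12.1, h12.2]
    have h1 : (1 : ℝ) ≤ |(g 0 : ℝ) + g 1 * liouvilleNumber 2 + g 2 * liouvilleNumber 4| := by
      simp only [h12.1, h12.2, Int.cast_zero, zero_mul, add_zero]
      exact_mod_cast Int.one_le_abs hg0
    linarith
  · -- the natural height `Hn` and the scale `N = K₀ + 3`
    set Hn : ℕ := ∑ i, (g i).natAbs with hHn
    have hHRn : HR = (Hn : ℝ) := by
      rw [hHR, hHn, Nat.cast_sum]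
      refine Finset.sum_congr rfl fun i _ => ?_
      simp only [Nat.cast_natAbs, Int.cast_abs]
    have hHn1 : 1 ≤ Hn := by
      obtain ⟨i, hi⟩ := Function.ne_iff.mp hg
      have hi' : g i ≠ 0 := by simpa using hi
      have h1 : 1 ≤ (g i).natAbs := Int.natAbs_pos.mpr hi'
      exact h1.trans (Finset.single_le_sum (f := fun i => (g i).natAbs) (fun _ _ => Nat.zero_le _)
        (Finset.mem_univ i))
    have hex : ∃ K : ℕ, 4 * Hn ≤ 2 ^ (K + 3)! := by
      refine ⟨4 * Hn, (Nat.lt_two_pow_self).le.trans (Nat.pow_le_pow_right (by norm_num) ?_)⟩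
      exact (Nat.le_add_right _ _).trans (Nat.self_le_factorial _)
    set K₀ : ℕ := Nat.find hex with hK₀
    have hK₀spec : 4 * Hn ≤ 2 ^ (K₀ + 3)! := Nat.find_spec hex
    set N : ℕ := K₀ + 3 with hN
    have hN3 : 3 ≤ N := by omega
    have hHN : 4 * Hn ≤ 2 ^ N ! := hK₀spec
    -- `(N+1)! ≤ 64 (1+Hn)^3`
    have hfac : (N + 1)! ≤ 64 * (1 + Hn) ^ 3 := by
      rcases Nat.eq_zero_or_pos K₀ with hz | hpos
      · have h24 : (N + 1)! = 24 := by rw [hN, hz]; rfl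
        have h1 : 1 ≤ (1 + Hn) ^ 3 := Nat.one_le_pow _ _ (by omega)
        omega
      · have hmin := Nat.find_min hex (m := K₀ - 1) (by omega)
        rw [show K₀ - 1 + 3 = K₀ + 2 by omega] at hmin
        have hlt : (K₀ + 2)! < 4 * Hn := (Nat.lt_two_pow_self).trans (not_le.mp hmin)
        have hK2 : K₀ + 2 ≤ (K₀ + 2)! := Nat.self_le_factorial _
        rw [hN, show K₀ + 3 + 1 = (K₀ + 2) + 1 + 1 by omega, Nat.factorial_succ, Nat.factorial_succ]
        have h1 : K₀ + 2 + 1 + 1 ≤ 4 * (1 + Hn) := by omega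
        have h2 : K₀ + 2 + 1 ≤ 4 * (1 + Hn) := by omega
        have h3 : (K₀ + 2)! ≤ 4 * (1 + Hn) := by omega
        calc (K₀ + 2 + 1 + 1) * ((K₀ + 2 + 1) * (K₀ + 2)!)
            ≤ (4 * (1 + Hn)) * ((4 * (1 + Hn)) * (4 * (1 + Hn))) :=
              Nat.mul_le_mul h1 (Nat.mul_le_mul h2 h3)
          _ = 64 * (1 + Hn) ^ 3 := by ring
    have hfacR : (((N + 1)! : ℕ) : ℝ) ≤ 64 * (1 + HR) ^ 3 := by
      rw [hHRn]; exact_mod_cast hfac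
    -- `|g₂| < 2^{(N+1)!}`
    have hsmall : |g 2| < (2 : ℤ) ^ (N + 1)! := by
      have h1 : (g 2).natAbs ≤ Hn :=
        Finset.single_le_sum (f := fun i => (g i).natAbs) (fun _ _ => Nat.zero_le _) (Finset.mem_univ 2)
      have h2 : Hn < 2 ^ N ! := by have := Nat.two_pow_pos (N !); omega
      have h3 : 2 ^ N ! ≤ 2 ^ (N + 1)! := Nat.pow_le_pow_right (by norm_num) (Nat.factorial_le (by omega))
      have h4 : (g 2).natAbs < 2 ^ (N + 1)! := by omega
      have h5 : (((g 2).natAbs : ℕ) : ℤ) < ((2 ^ (N + 1)! : ℕ) : ℤ) := by exact_mod_cast h4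
      rwa [Int.natCast_natAbs, Nat.cast_pow, Nat.cast_ofNat] at h5
    -- at a scale `K ∈ {N, N+1}` where the truncated form is non-zero, conclude
    have key : ∀ K, N ≤ K → K ≤ N + 1 →
        (g 0 : ℝ) + g 1 * partialSum 2 K + g 2 * partialSum 4 K ≠ 0 →
        Real.exp (-((1 + HR) ^ 11)) ≤ |(g 0 : ℝ) + g 1 * liouvilleNumber 2 + g 2 * liouvilleNumber 4| := by
      intro K hNK hKN hne
      have hK3 : 3 ≤ K := hN3.trans hNK
      have hlowK := form_scale_lower g K hne
      have happK := form_approx g K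
      rw [← hHR] at happK
      -- separation: `2 · (2H/2^{(K+1)!}) ≤ 1/8^{K!}`
      have hA : 4 * HR ≤ (2 : ℝ) ^ K ! := by
        rw [hHRn]
        have : 4 * Hn ≤ 2 ^ K ! := hHN.trans (Nat.pow_le_pow_right (by norm_num) (Nat.factorial_le hNK))
        exact_mod_cast this
      have hB : (8 : ℝ) ^ K ! ≤ (2 ^ K) ^ K ! := by
        refine pow_le_pow_left₀ (by norm_num) ?_ _
        calc (8 : ℝ) = 2 ^ 3 := by norm_num
          _ ≤ 2 ^ K := pow_le_pow_right₀ (by norm_num) hK3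
      have hB' : ((2 : ℝ) ^ K) ^ K ! = (2 ^ K !) ^ K := by rw [← pow_mul, ← pow_mul, mul_comm]
      have hC : (2 : ℝ) ^ (K + 1)! = 2 ^ K ! * (2 ^ K !) ^ K := by
        rw [Nat.factorial_succ, show (K + 1) * K ! = K ! * (K + 1) by ring, pow_mul, pow_succ]; ring
      have hsep : 2 * (2 * HR / 2 ^ (K + 1)!) ≤ 1 / (8 : ℝ) ^ K ! := by
        rw [← mul_div_assoc, div_le_div_iff₀ (by positivity) (by positivity), one_mul]
        calc 2 * (2 * HR) * (8 : ℝ) ^ K ! = (4 * HR) * 8 ^ K ! := by ring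
          _ ≤ 2 ^ K ! * (2 ^ K) ^ K ! := mul_le_mul hA hB (by positivity) (by positivity)
          _ = 2 ^ K ! * (2 ^ K !) ^ K := by rw [hB']
          _ = 2 ^ (K + 1)! := hC.symm
      -- `|φ| ≥ |Φ_K| − |φ − Φ_K| ≥ (1/8^{K!})/2`
      have hφK : 1 / (8 : ℝ) ^ K ! / 2 ≤ |(g 0 : ℝ) + g 1 * liouvilleNumber 2 + g 2 * liouvilleNumber 4| := by
        have ht := abs_sub_abs_le_abs_sub ((g 0 : ℝ) + g 1 * partialSum 2 K + g 2 * partialSum 4 K)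
          ((g 0 : ℝ) + g 1 * liouvilleNumber 2 + g 2 * liouvilleNumber 4)
        rw [abs_sub_comm] at ht
        linarith
      refine le_trans ?_ hφK
      -- `exp(−(1+H)^11) ≤ (1/8^{K!})/2`: `2·8^{K!} ≤ exp(1 + 3K!) ≤ exp((1+H)^11)`
      have hKfac : ((K ! : ℕ) : ℝ) ≤ 64 * (1 + HR) ^ 3 := by
        have h1 : K ! ≤ (N + 1)! := Nat.factorial_le hKN
        have h2 : ((K ! : ℕ) : ℝ) ≤ (((N + 1)! : ℕ) : ℝ) := by exact_mod_cast h1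
        exact h2.trans hfacR
      have hKfac1 : (1 : ℝ) ≤ ((K ! : ℕ) : ℝ) := by exact_mod_cast Nat.succ_le_of_lt (Nat.factorial_pos K)
      have hX1 : (1 : ℝ) ≤ HR := by rw [hHRn]; exact_mod_cast hHn1
      have hX2 : (2 : ℝ) ≤ 1 + HR := by linarith
      have hX3 : (8 : ℝ) ≤ (1 + HR) ^ 3 := by
        have := pow_le_pow_left₀ (by norm_num) hX2 3
        norm_num at this
        linarith
      have hX8 : (256 : ℝ) ≤ (1 + HR) ^ 8 := by
        have := pow_le_pow_left₀ (by norm_num) hX2 8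
        norm_num at this
        linarith
      have hpoly : 1 + 3 * ((K ! : ℕ) : ℝ) ≤ (1 + HR) ^ 11 := by
        have e : (1 + HR) ^ 11 = (1 + HR) ^ 8 * (1 + HR) ^ 3 := by ring
        rw [e]
        have h0 : (0 : ℝ) ≤ (1 + HR) ^ 3 := by positivity
        nlinarith [mul_le_mul_of_nonneg_right hX8 h0]
      have hexpK : 2 * (8 : ℝ) ^ K ! ≤ Real.exp ((1 + HR) ^ 11) := by
        calc 2 * (8 : ℝ) ^ K ! ≤ Real.exp 1 * Real.exp 3 ^ K ! :=
              mul_le_mul two_le_exp_one (pow_le_pow_left₀ (by norm_num) eight_le_exp_three _)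
                (by positivity) (Real.exp_pos _).le
          _ = Real.exp (1 + 3 * ((K ! : ℕ) : ℝ)) := by
              rw [← Real.exp_nat_mul, ← Real.exp_add]; ring_nf
          _ ≤ Real.exp ((1 + HR) ^ 11) := Real.exp_le_exp.mpr hpoly
      rw [Real.exp_neg, div_div, one_div]
      exact inv_anti₀ (by positivity) (by linarith [hexpK])
    by_cases hΦN : (g 0 : ℝ) + g 1 * partialSum 2 N + g 2 * partialSum 4 N = 0
    · have hΦN1 : (g 0 : ℝ) + g 1 * partialSum 2 (N + 1) + g 2 * partialSum 4 (N + 1) ≠ 0 :=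
        fun h1 => h12 (form_two_scale g N hΦN h1 hsmall)
      exact key (N + 1) (Nat.le_succ N) le_rfl hΦN1
    · exact key N le_rfl (Nat.le_succ N) hΦN

end FormBound

end Summit.Schanuel.Schanuel.Theorems.RootDecomp1KCommonRadixCell

end
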